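import Summits.Ventures.Crystal3D.Theorems.StickyWulffConstantCoaxialWallLawVicinalReachCore
import Summits.Ventures.Crystal3D.Theorems.StickyWulffConstantGenericWallFloorStackLedgerOneSidedReachWith
import Summits.Ventures.Crystal3D.Theorems.StickyWulffConstantCoaxialWallLawLedgerWithCharge
import HarnessLib

/-!
# Restatement programme, reach cone: the one-sided reach links AT explicit constants (`R₀ = 10`)

HONEST FRAMING. Venture `Summits/Ventures/Crystal3D` (cell `crystal3d-full`); helper for the crux `TextureLiminf` (stmt-Ventures-19483,
line `TexShadow`) and lane F's debt F-U (cf-p1 DECISION (lxvii), 2026-08-29).  Rung credit only (census-free, standard axioms); F-C1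
not moved; E1 (`ExactOnly`) and `StarPairFar` stay BY NAME.  The links above leaf L1
(`twoSlabAdhesionWith_stackLedger_oneSided_reach`, …StackLedgerOneSidedReachWith) re-derived in the explicit-constant currency,
proofs = the originals' proofs (`…ChainTorsionWide`, `…VicinalReachCore`) with `At` ↦ `With`:

* `twoSlabLedgerWith_oneSided_reach_wide` (↔ `twoSlabLedgerAt_oneSided_reach_wide`),
* `twoSlabLedgerWith_oneSided_of_level_third_wide` (↔ `twoSlabLedgerAt_oneSided_of_level_third_wide`),
* `coaxialOnWith_of_offReach` (↔ `coaxialTwoSlabAdhesion_of_offReach`): the conclusion of `CoaxialTwoSlabAdhesionOnWith C 10` for the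
  pair, ONE `C = (240√2π + 4440·42)/2 + 16000 + K` for all data.
-/

noncomputable section

namespace Summit.Ventures.Crystal3D.Theorems

open Summit.Ventures.Crystal3D Finset
open Literature.MathematicalPhysics.StatisticalMechanics (fccStacking barlowStacking IsHaggSeq contactDeficiency
  isHaggSeq_const)
open scoped InnerProductSpace

open scoped Classical in
/-- **`TwoSlabLedgerWith (c₀ + K) 10 (½κ₁)` from grain 1's walkers alone, WIDE tilt, frame set `chainFrames z u₁`**, modulo E1 and
`StarPairFar`; one absolute `K`. -/
theorem twoSlabLedgerWith_oneSided_reach_wide : ∃ K : ℝ, ∀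
    {s₀ : EuclideanSpace ℝ (Fin 3)} (_hs₀ : s₀ ∈ fccSlots)
    (_hcert : ExactOnly 0 (fccSlots.filter fun w => 0 < ⟪w, s₀⟫_ℝ)) (_hSP : StarPairFar)
    (A₁ : EuclideanSpace ℝ (Fin 3) ≃ₗᵢ[ℝ] EuclideanSpace ℝ (Fin 3)) (t₁ : EuclideanSpace ℝ (Fin 3))
    (A₂ : EuclideanSpace ℝ (Fin 3) ≃ₗᵢ[ℝ] EuclideanSpace ℝ (Fin 3)) (t₂ : EuclideanSpace ℝ (Fin 3))
    {z : EuclideanSpace ℝ (Fin 3)} (_hz : ‖z‖ = 1) (_hze : ‖z - EuclideanSpace.single (2 : Fin 3) (1 : ℝ)‖ ≤ 1 / 3)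
    {u₁ : EuclideanSpace ℝ (Fin 3)} (_hu₁ : u₁ ∈ fccSlots) (_hsteep₁ : Real.sqrt 2 / 2 ≤ ⟪A₁ u₁, z⟫_ℝ)
    (_hoff : ∀ y ∈ reachSet A₁ t₁ (chainFrames z A₁ u₁), y ∉ (fun q => A₂ q + t₂) '' fccStacking 1 (Real.sqrt (2 / 3))),
    TwoSlabLedgerWith ((240 * Real.sqrt 2 * Real.pi + 4440 * (4 * 10 + 2)) / 2 + 16000 + K) 10
      (Real.sqrt 2 * |⟪A₁ u₁, EuclideanSpace.single (2 : Fin 3) (1 : ℝ)⟫_ℝ| / 2) A₁ t₁ A₂ t₂ := by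
  obtain ⟨K, hK⟩ := twoSlabAdhesionWith_stackLedger_oneSided_reach
  refine ⟨K, ?_⟩
  intro s₀ hs₀ hcert hSP A₁ t₁ A₂ t₂ z hz hze u₁ hu₁ hsteep₁ hoff
  exact hK hs₀ hcert (doubleStarCoaxialAt_of_starPairFar hSP) (capPairCoaxial_of_starPairFar hSP) A₁ t₁ A₂ t₂ hz hze hu₁
    hsteep₁ _ (fun _ hS hW hlast => frame_mem_chainFrames_of_stack hS hW hlast) hoff

open scoped Classical in
/-- **Level-⅓ pairs outside the two cosets, WIDE tilt, explicit constants**: translation or twin-about-`n₁` pair, slot `u₁` with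
`⟪A₁u₁, e₃⟫ ≥ 9/20`, `n₁ ∋ u₁` ⇒ `TwoSlabLedgerWith (c₀ + K) 10 ((√2/2)⟪A₁u₁, e₃⟫)`; one absolute `K`. -/
theorem twoSlabLedgerWith_oneSided_of_level_third_wide : ∃ K : ℝ, ∀
    {s₀ : EuclideanSpace ℝ (Fin 3)} (_hs₀ : s₀ ∈ fccSlots)
    (_hcert : ExactOnly 0 (fccSlots.filter fun w => 0 < ⟪w, s₀⟫_ℝ)) (_hSP : StarPairFar)
    (A₁ : EuclideanSpace ℝ (Fin 3) ≃ₗᵢ[ℝ] EuclideanSpace ℝ (Fin 3)) (t₁ : EuclideanSpace ℝ (Fin 3))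
    (A₂ : EuclideanSpace ℝ (Fin 3) ≃ₗᵢ[ℝ] EuclideanSpace ℝ (Fin 3)) (t₂ : EuclideanSpace ℝ (Fin 3))
    {u₁ n₁ : EuclideanSpace ℝ (Fin 3)} (_hu₁ : u₁ ∈ fccSlots)
    (_hup : (9 / 20 : ℝ) ≤ ⟪A₁ u₁, EuclideanSpace.single (2 : Fin 3) (1 : ℝ)⟫_ℝ) (_hn₁ : ‖n₁‖ = 1)
    (_hmenu₁ : ∀ w ∈ fccSlots, ⟪A₁ w, n₁⟫_ℝ = 0 ∨ ⟪A₁ w, n₁⟫_ℝ = Real.sqrt (2 / 3) ∨ ⟪A₁ w, n₁⟫_ℝ = -Real.sqrt (2 / 3))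
    (_hun : ⟪A₁ u₁, n₁⟫_ℝ = Real.sqrt (2 / 3))
    (_hΛ : A₂ '' fccStacking 1 (Real.sqrt (2 / 3)) = A₁ '' fccStacking 1 (Real.sqrt (2 / 3)) ∨
      A₂ '' fccStacking 1 (Real.sqrt (2 / 3)) = twinFrame A₁ n₁ '' fccStacking 1 (Real.sqrt (2 / 3)))
    (_h3 : A₁.symm ((3 : ℝ) • (t₂ - t₁)) ∈ fccStacking 1 (Real.sqrt (2 / 3)))
    (_hnot : ∀ a b : ℤ, A₁.symm (t₂ - t₁ - (a : ℝ) • (Real.sqrt (2 / 3) • n₁) -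
      (b : ℝ) • (Real.sqrt (2 / 3) • ((2 * Real.sqrt (2 / 3)) • A₁ u₁ - n₁))) ∉ fccStacking 1 (Real.sqrt (2 / 3))),
    TwoSlabLedgerWith ((240 * Real.sqrt 2 * Real.pi + 4440 * (4 * 10 + 2)) / 2 + 16000 + K) 10
      (Real.sqrt 2 * ⟪A₁ u₁, EuclideanSpace.single (2 : Fin 3) (1 : ℝ)⟫_ℝ / 2) A₁ t₁ A₂ t₂ := by
  obtain ⟨K, hK⟩ := twoSlabLedgerWith_oneSided_reach_wide
  refine ⟨K, ?_⟩
  intro s₀ hs₀ hcert hSP A₁ t₁ A₂ t₂ u₁ n₁ hu₁ hup hn₁ hmenu₁ hun hΛ h3 hnot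
  obtain ⟨z, hz, hze, hsteep⟩ := exists_tilt_vertical_wide
    (by rw [LinearIsometryEquiv.norm_map, norm_eq_one_of_mem_fccSlots hu₁]) hup
  have hoff : ∀ y ∈ reachSet A₁ t₁ (chainFrames z A₁ u₁), y ∉ (fun q => A₂ q + t₂) '' fccStacking 1 (Real.sqrt (2 / 3)) := by
    rcases hΛ with hΛ | hΛ
    · exact oneSided_offReach_of_level_third z A₁ t₁ A₂ t₂ hΛ hu₁ hn₁ hmenu₁ hun h3 hnot
    · exact oneSided_offReach_of_level_third_twin z A₁ t₁ A₂ t₂ hu₁ hn₁ hmenu₁ hun hΛ h3 hnot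
  have h := hK hs₀ hcert hSP A₁ t₁ A₂ t₂ hz hze hu₁ hsteep hoff
  rwa [abs_of_nonneg (by linarith : (0 : ℝ) ≤ ⟪A₁ u₁, EuclideanSpace.single (2 : Fin 3) (1 : ℝ)⟫_ℝ)] at h

open scoped Classical in
/-- **Off-reach for one admissible vertical, at explicit constants** (`coaxialTwoSlabAdhesion_of_offReach` in the With-currency):
admissible `(z, u)`, an admissible axis `m` of the pair dominated by `u`, grain 1's reach set over `chainFrames z A₁ u` missing
`A₂·Λ₀ + t₂` ⇒ the conclusion of `CoaxialTwoSlabAdhesionOnWith ((240√2π + 4440·42)/2 + 16000 + K) 10` for the pair; one absolute `K`. -/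
theorem coaxialOnWith_of_offReach : ∃ K : ℝ, ∀
    {s₀ : EuclideanSpace ℝ (Fin 3)} (_hs₀ : s₀ ∈ fccSlots)
    (_hcert : ExactOnly 0 (fccSlots.filter fun w => 0 < ⟪w, s₀⟫_ℝ)) (_hSP : StarPairFar)
    (A₁ : EuclideanSpace ℝ (Fin 3) ≃ₗᵢ[ℝ] EuclideanSpace ℝ (Fin 3)) (t₁ : EuclideanSpace ℝ (Fin 3))
    (A₂ : EuclideanSpace ℝ (Fin 3) ≃ₗᵢ[ℝ] EuclideanSpace ℝ (Fin 3)) (t₂ : EuclideanSpace ℝ (Fin 3))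
    {z : EuclideanSpace ℝ (Fin 3)} (_hz : ‖z‖ = 1) (_hze : ‖z - EuclideanSpace.single (2 : Fin 3) (1 : ℝ)‖ ≤ 1 / 3)
    {u : EuclideanSpace ℝ (Fin 3)} (_hu : u ∈ fccSlots) (_hsteep : Real.sqrt 2 / 2 ≤ ⟪A₁ u, z⟫_ℝ)
    {m : EuclideanSpace ℝ (Fin 3)} (_hm : ‖m‖ = 1)
    (_hmenum : ∀ w ∈ fccSlots, ⟪A₁ w, m⟫_ℝ = 0 ∨ ⟪A₁ w, m⟫_ℝ = Real.sqrt (2 / 3) ∨ ⟪A₁ w, m⟫_ℝ = -Real.sqrt (2 / 3))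
    (_hadm : A₂ '' fccStacking 1 (Real.sqrt (2 / 3)) = A₁ '' fccStacking 1 (Real.sqrt (2 / 3)) ∨
      A₂ '' fccStacking 1 (Real.sqrt (2 / 3)) = twinFrame A₁ m '' fccStacking 1 (Real.sqrt (2 / 3)))
    (_hdom : Real.sqrt (1 - ⟪m, EuclideanSpace.single (2 : Fin 3) (1 : ℝ)⟫_ℝ ^ 2) ≤
      Real.sqrt 2 * ⟪A₁ u, EuclideanSpace.single (2 : Fin 3) (1 : ℝ)⟫_ℝ)
    (_hoff : ∀ y ∈ reachSet A₁ t₁ (chainFrames z A₁ u), y ∉ (fun q => A₂ q + t₂) '' fccStacking 1 (Real.sqrt (2 / 3))),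
    ∃ (L : EuclideanSpace ℝ (Fin 3) ≃ₗᵢ[ℝ] EuclideanSpace ℝ (Fin 3))
        (s₁ s₂ : EuclideanSpace ℝ (Fin 3)) (σ σ' : ℤ → ℤ), IsHaggSeq σ ∧ IsHaggSeq σ' ∧
        (fun p => A₁ p + t₁) '' fccStacking 1 (Real.sqrt (2 / 3)) ⊆
          (fun p => L p + s₁) '' barlowStacking 1 (Real.sqrt (2 / 3)) σ ∧
        (fun p => A₂ p + t₂) '' fccStacking 1 (Real.sqrt (2 / 3)) ⊆
          (fun p => L p + s₂) '' barlowStacking 1 (Real.sqrt (2 / 3)) σ' ∧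
        TwoSlabLedgerWith ((240 * Real.sqrt 2 * Real.pi + 4440 * (4 * 10 + 2)) / 2 + 16000 + K) 10
          ((1 / 2 : ℝ) * Real.sqrt (1 - ⟪L (EuclideanSpace.single (2 : Fin 3) (1 : ℝ)),
            (EuclideanSpace.single (2 : Fin 3) (1 : ℝ))⟫_ℝ ^ 2)) A₁ t₁ A₂ t₂ := by
  obtain ⟨K, hK⟩ := twoSlabLedgerWith_oneSided_reach_wide
  refine ⟨K, ?_⟩
  intro s₀ hs₀ hcert hSP A₁ t₁ A₂ t₂ z hz hze u hu hsteep m hm hmenum hadm hdom hoff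
  have hcell := hK hs₀ hcert hSP A₁ t₁ A₂ t₂ hz hze hu hsteep hoff
  obtain ⟨L, hLΛ, hLe⟩ := exists_frame_of_menu A₁ hm hmenum
  have hsub₁ := movedFcc_subset_frame hLΛ t₁
  have hq : (1 / 2 : ℝ) * Real.sqrt (1 - ⟪L (EuclideanSpace.single (2 : Fin 3) (1 : ℝ)),
      (EuclideanSpace.single (2 : Fin 3) (1 : ℝ))⟫_ℝ ^ 2) ≤
      Real.sqrt 2 * |⟪A₁ u, EuclideanSpace.single (2 : Fin 3) (1 : ℝ)⟫_ℝ| / 2 := by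
    rw [hLe]
    have := le_abs_self ⟪A₁ u, EuclideanSpace.single (2 : Fin 3) (1 : ℝ)⟫_ℝ
    have h2 : 0 ≤ Real.sqrt 2 := Real.sqrt_nonneg 2
    nlinarith [hdom, mul_le_mul_of_nonneg_left this h2]
  rcases hadm with hadm | hadm
  · exact coaxialOnWith_of_twoSlabLedgerWith_frame hcell L t₁ t₂ isHaggSeq_const isHaggSeq_const hsub₁
      (movedFcc_subset_frame (hLΛ.trans hadm.symm) t₂) hq
  · exact coaxialOnWith_of_twoSlabLedgerWith_frame hcell L t₁ t₂ isHaggSeq_const isHaggSeq_negConst hsub₁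
      (movedFcc_subset_frame_negConst (twin_image_eq_frame_negConst hm hLΛ hLe hadm) t₂) hq

end Summit.Ventures.Crystal3D.Theorems

end
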